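import Summits.CriticalPhenomena.Ising3DConformalLimit.Theorems.StrandShadow.Negative.ClusterDecomposition
import Summits.CriticalPhenomena.Ising3DConformalLimit.Theorems.StrandShadow.Negative.PairSplitDeletion
import Summits.CriticalPhenomena.Ising3DConformalLimit.Theorems.FKParityRobustnessParityBoundCurrents
import Literature.Probability.LatticeModels.WeightedCurrentsIdentities
import Literature.Probability.LatticeModels.LoopO1
import Literature.Probability.LatticeModels.ModifiedSimonInequality
import HarnessLib

/-!
# The junk term of the odd-cluster cut: `J · Z_∅ ≤ Z_A · Z_{a₂a₃}` (crux `StrandShadow`, stmt-CriticalPhenomena-14626)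

Support file for the stub `junkMass_mul_loopZero_le` of the line `odd-cluster-cut-exact-helper`
(route `FKParityRobustness`, sub-problem `Ising3DConformalLimit`).  Finite graph `G`, `β ≥ 0`,
`t = tanh β`, four marked vertices `a : Fin 4 → V` (injective), `𝒯_S = tJoins G univ S`,
`Z_S = Σ_{F ∈ 𝒯_S} t^{|F|}` the sourced loop-O(1) partition functions, and the junk mass
`J = Σ_{F ∈ 𝒯_{a₀a₁} : a₀ ↔ a₂, a₀ ↔ a₃ in F} t^{|F|}`.

Proof by random currents: `cosh(β)^{|E|} J = Σ_{∂n = a₀a₁} w_β(n) 1[a₀ ↔ a₂, a₀ ↔ a₃ in odd(n)]`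
(`tsum_sources_eweight_mul_apply_oddPart`), `odd(n₁) ⊆ trace(n₁ + n₂)`
(`coe_oddPart_subset_traced_add`), so `cosh^{2|E|} J Z_∅ ≤ Σ 1{∂n₁ = a₀a₁}1{∂n₂ = ∅} w w 1[a₃ ∈ C(a₂)]`,
which by the pair switching `Current.tsum_epairWeight_switch_pair` is
`Z_β[A] Z_β[a₂a₃] = cosh^{2|E|} Z_A Z_{a₂a₃}` (`Z_β[S] = cosh^{|E|} Z_S`, the `sinh/cosh` expansion).

References: M. Aizenman, Comm. Math. Phys. 86 (1982), Prop. 5.1 [AizenmanCMP1982];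
H. Duminil-Copin, arXiv:1607.06933, Lemma 2.2, Remark 3.4 [DuminilCopin2016].
-/

noncomputable section

open Finset SimpleGraph
open Literature.Probability.LatticeModels
open Summit.CriticalPhenomena.Ising3DConformalLimit.StrandShadowNegative (Rch clusterEdges)

namespace Summit.CriticalPhenomena.Ising3DConformalLimit.Theorems.StrandShadowOddCut

open scoped Classical
open scoped ENNReal symmDiff

section CurrentSide

variable {V : Type*} [Fintype V] [DecidableEq V] (G : SimpleGraph V) [DecidableRel G.Adj]

/-- Indicators are monotone along implications (`ℝ≥0∞`). -/
theorem junkB_ite_le_ite {c d : Prop} [Decidable c] [Decidable d] (h : c → d) :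
    (if c then (1 : ℝ≥0∞) else 0) ≤ (if d then 1 else 0) := by
  by_cases hc : c
  · rw [if_pos hc, if_pos (h hc)]
  · rw [if_neg hc]
    exact bot_le

omit [DecidableEq V] in
/-- If the odd part of `n₁` joins `a₀ ↔ a₂` and `a₀ ↔ a₃`, then `a₃ ∈ C_{n₁+n₂}(a₂)` in the double
current (`odd(n₁) ⊆ trace(n₁ + n₂)`). -/
theorem junkB_mem_cluster_of_reachable (a : Fin 4 → V) (p : Current G × Current G)
    (h : (SimpleGraph.fromEdgeSet (↑((univ.filter fun e : G.edgeFinset => Odd (p.1 e)).map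
          (Function.Embedding.subtype _)) : Set (Sym2 V))).Reachable (a 0) (a 2) ∧
        (SimpleGraph.fromEdgeSet (↑((univ.filter fun e : G.edgeFinset => Odd (p.1 e)).map
          (Function.Embedding.subtype _)) : Set (Sym2 V))).Reachable (a 0) (a 3)) :
    a 3 ∈ (p.1 + p.2).cluster (a 2) := by
  have hle : SimpleGraph.fromEdgeSet (↑((univ.filter fun e : G.edgeFinset => Odd (p.1 e)).map
        (Function.Embedding.subtype _)) : Set (Sym2 V)) ≤
      Literature.Probability.Percolation.openGraph (p.1 + p.2).traced :=
    SimpleGraph.fromEdgeSet_mono (coe_oddPart_subset_traced_add p.1 p.2)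
  exact Current.mem_cluster_iff.2 ((h.1.symm.trans h.2).mono hle)

/-- **One-copy odd-part pushforward with an event**: for `β ≥ 0`, a source set `S` and an event
`P` on edge sets, `Σ_{∂n = S} w_β(n) 1[odd(n) ∈ P] = cosh(β)^{|E|} Σ_{F ∈ 𝒯_S ∩ P} tanh(β)^{|F|}`
(`tsum_sources_eweight_mul_apply_oddPart` and `sinh^k cosh^{|E|−k} = cosh^{|E|} tanh^k`). -/
theorem junkB_pushforward {β : ℝ} (hβ : 0 ≤ β) (S : Finset V) (P : Finset (Sym2 V) → Prop)
    [DecidablePred P] :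
    ∑' n : Current G, (if n.sources = S then n.eweight (fun _ : G.edgeFinset => β) else 0) *
        (if P ((univ.filter fun e : G.edgeFinset => Odd (n e)).map (Function.Embedding.subtype _))
          then 1 else 0) =
      ENNReal.ofReal (Real.cosh β ^ #G.edgeFinset *
        ∑ F ∈ (tJoins G Set.univ S).filter P, Real.tanh β ^ #F) := by
  have ht : 0 ≤ Real.tanh β := by
    rw [Real.tanh_eq_sinh_div_cosh]
    exact div_nonneg (Real.sinh_nonneg_iff.2 hβ) (Real.cosh_pos β).le
  have hT : tJoins G Set.univ S =
      G.edgeFinset.powerset.filter (fun F => ∀ v, Odd #(F.filter (v ∈ ·)) ↔ v ∈ S) := by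
    unfold tJoins
    exact Finset.filter_congr fun F _ => by simp only [Set.subset_univ, true_and]
  rw [tsum_sources_eweight_mul_apply_oddPart hβ S (fun F => if P F then 1 else 0),
    Finset.mul_sum, ENNReal.ofReal_sum_of_nonneg (fun F _ =>
      mul_nonneg (pow_nonneg (Real.cosh_pos β).le _) (pow_nonneg ht _)),
    Finset.sum_filter, hT, Finset.sum_filter]
  refine Finset.sum_congr rfl fun F hF => ?_
  have hle : #F ≤ #G.edgeFinset := Finset.card_le_card (Finset.mem_powerset.1 hF)
  by_cases hS : (∀ v, Odd #(F.filter (v ∈ ·)) ↔ v ∈ S)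
  · rw [if_pos hS, if_pos hS]
    by_cases hP : P F
    · rw [if_pos hP, if_pos hP, mul_one, sinh_pow_mul_cosh_pow_sub β hle]
    · rw [if_neg hP, if_neg hP, mul_zero]
  · rw [if_neg hS, if_neg hS]

/-- **The current-side inequality** (`ℝ≥0∞`): with `Z[S]` the current sums at uniform coupling
`β ≥ 0` and `J` the junk mass,
`cosh(β)^{|E|} J · Z[∅] ≤ Z[{a 0, a 1, a 2, a 3}] · Z[{a 2, a 3}]`
(pushforward, `odd(n₁) ⊆ trace(n₁ + n₂)`, and the pair switching with the pair `{a 2, a 3}`). -/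
theorem junkB_current_ineq {β : ℝ} (hβ : 0 ≤ β) (a : Fin 4 → V) (ha : Function.Injective a) :
    ENNReal.ofReal (Real.cosh β ^ #G.edgeFinset *
        ∑ F ∈ (tJoins G Set.univ {a 0, a 1}).filter (fun F : Finset (Sym2 V) =>
            (SimpleGraph.fromEdgeSet (↑F : Set (Sym2 V))).Reachable (a 0) (a 2) ∧
            (SimpleGraph.fromEdgeSet (↑F : Set (Sym2 V))).Reachable (a 0) (a 3)),
          Real.tanh β ^ #F) *
        ecurrentSum (fun _ : G.edgeFinset => β) ∅ ≤
      ecurrentSum (fun _ : G.edgeFinset => β) (Finset.univ.image a) *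
        ecurrentSum (fun _ : G.edgeFinset => β) {a 2, a 3} := by
  have hK : ∀ _e : G.edgeFinset, 0 ≤ β := fun _ => hβ
  have h01 : ({a 0} : Finset V) ∆ {a 1} = {a 0, a 1} :=
    Current.symmDiff_singleton_eq_pair (ha.ne (by decide))
  have h23 : ({a 2} : Finset V) ∆ {a 3} = {a 2, a 3} :=
    Current.symmDiff_singleton_eq_pair (ha.ne (by decide))
  -- the four-source set `{a 0, a 1} ∆ {a 2} ∆ {a 3}` of the injective `a` is its image
  have hA : ({a 0, a 1} : Finset V) ∆ ({a 2} ∆ {a 3}) = Finset.univ.image a := by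
    rw [← h01, symmDiff_assoc]
    ext v
    simp only [Finset.mem_symmDiff, Finset.mem_singleton, Finset.mem_image, Finset.mem_univ,
      true_and]
    constructor
    · intro h
      by_cases h0 : v = a 0
      · exact ⟨0, h0.symm⟩
      by_cases h1 : v = a 1
      · exact ⟨1, h1.symm⟩
      by_cases h2 : v = a 2
      · exact ⟨2, h2.symm⟩
      by_cases h3 : v = a 3
      · exact ⟨3, h3.symm⟩
      simp only [h0, h1, h2, h3, or_self, not_false_eq_true, and_true] at h
    · rintro ⟨i, rfl⟩
      fin_cases i <;> simp only [ha.eq_iff] <;> decide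
  rw [← junkB_pushforward G hβ {a 0, a 1} (fun F : Finset (Sym2 V) =>
      (SimpleGraph.fromEdgeSet (↑F : Set (Sym2 V))).Reachable (a 0) (a 2) ∧
      (SimpleGraph.fromEdgeSet (↑F : Set (Sym2 V))).Reachable (a 0) (a 3))]
  calc (∑' n : Current G, (if n.sources = {a 0, a 1} then n.eweight (fun _ : G.edgeFinset => β) else 0) *
          (if (SimpleGraph.fromEdgeSet (↑((univ.filter fun e : G.edgeFinset => Odd (n e)).map
                (Function.Embedding.subtype _)) : Set (Sym2 V))).Reachable (a 0) (a 2) ∧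
              (SimpleGraph.fromEdgeSet (↑((univ.filter fun e : G.edgeFinset => Odd (n e)).map
                (Function.Embedding.subtype _)) : Set (Sym2 V))).Reachable (a 0) (a 3)
            then 1 else 0)) * ecurrentSum (fun _ : G.edgeFinset => β) ∅
        = ∑' p : Current G × Current G, epairWeight (fun _ : G.edgeFinset => β) {a 0, a 1} ∅ p *
          (if (SimpleGraph.fromEdgeSet (↑((univ.filter fun e : G.edgeFinset => Odd (p.1 e)).map
                (Function.Embedding.subtype _)) : Set (Sym2 V))).Reachable (a 0) (a 2) ∧
              (SimpleGraph.fromEdgeSet (↑((univ.filter fun e : G.edgeFinset => Odd (p.1 e)).map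
                (Function.Embedding.subtype _)) : Set (Sym2 V))).Reachable (a 0) (a 3)
            then 1 else 0) := by
        unfold ecurrentSum
        rw [tsum_mul_tsum_eq_tsum_prod]
        refine tsum_congr fun p => ?_
        rw [epairWeight_eq_mul]
        ring
    _ ≤ ∑' p : Current G × Current G, epairWeight (fun _ : G.edgeFinset => β) {a 0, a 1} ∅ p *
          ((fun _ : Current G => (1 : ℝ≥0∞)) (p.1 + p.2) *
            (if a 3 ∈ (p.1 + p.2).cluster (a 2) then 1 else 0)) := by
        refine ENNReal.tsum_le_tsum fun p => mul_le_mul' le_rfl ?_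
        rw [one_mul]
        exact junkB_ite_le_ite (junkB_mem_cluster_of_reachable G a p)
    _ = ∑' p : Current G × Current G,
          epairWeight (fun _ : G.edgeFinset => β) ({a 0, a 1} ∆ ({a 2} ∆ {a 3})) ({a 2} ∆ {a 3}) p *
            (fun _ : Current G => (1 : ℝ≥0∞)) (p.1 + p.2) :=
        (Current.tsum_epairWeight_switch_pair hK {a 0, a 1} (a 2) (a 3) (fun _ => 1)).symm
    _ = ecurrentSum (fun _ : G.edgeFinset => β) (Finset.univ.image a) *
          ecurrentSum (fun _ : G.edgeFinset => β) {a 2, a 3} := by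
        rw [hA, h23, ← tsum_epairWeight]
        exact tsum_congr fun p => mul_one _

end CurrentSide

/-- **junkMass_mul_loopZero_le** (finite graph, `β ≥ 0`, `a` injective): the junk mass of the
formal crux — the `{a₀,a₁}`-joins whose `a₀`-cluster swallows both `a₂` and `a₃` — satisfies
`J · Z∅ ≤ Z_A · Z_{a₂a₃}` (loop-O(1) partition functions at `t = tanh β`), i.e.
`ℓ^{a₀a₁}[a₂, a₃ ∈ V(K_{a₀})] ≤ ⟨σ_A⟩·⟨σ_{a₂}σ_{a₃}⟩/⟨σ_{a₀}σ_{a₁}⟩`.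
Proof: `odd(n₁) ⊆ trace(n₁+n₂)` (trace dictionary) and the switching lemma with the pair
`{a₂,a₃}`: `Σ_{∂n₁={a₀,a₁}, ∂n₂=∅} 1[a₂ ↔ a₃] = Z[A]·Z[{a₂,a₃}]`. -/
theorem junkMass_mul_loopZero_le :
    ∀ (V : Type) [Fintype V] [DecidableEq V] (G : SimpleGraph V) [DecidableRel G.Adj] (β : ℝ),
      0 ≤ β → ∀ a : Fin 4 → V, Function.Injective a →
      (let t : ℝ := Real.tanh β
       (∑ F ∈ (tJoins G Set.univ {a 0, a 1}).filter (fun F : Finset (Sym2 V) =>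
            (SimpleGraph.fromEdgeSet (↑F : Set (Sym2 V))).Reachable (a 0) (a 2) ∧
            (SimpleGraph.fromEdgeSet (↑F : Set (Sym2 V))).Reachable (a 0) (a 3)),
          t ^ F.card) * loopO1PartitionFunction G t ∅
        ≤ loopO1PartitionFunction G t (Finset.univ.image a) * loopO1PartitionFunction G t {a 2, a 3}) := by
  intro V _ _ G _ β hβ a ha
  dsimp only
  have ht : 0 ≤ Real.tanh β := by
    rw [Real.tanh_eq_sinh_div_cosh]
    exact div_nonneg (Real.sinh_nonneg_iff.2 hβ) (Real.cosh_pos β).le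
  set cE : ℝ := Real.cosh β ^ #G.edgeFinset with hcE
  set Zt : Finset V → ℝ := fun S => loopO1PartitionFunction G (Real.tanh β) S with hZt
  set J : ℝ := ∑ F ∈ (tJoins G Set.univ {a 0, a 1}).filter (fun F : Finset (Sym2 V) =>
      (SimpleGraph.fromEdgeSet (↑F : Set (Sym2 V))).Reachable (a 0) (a 2) ∧
      (SimpleGraph.fromEdgeSet (↑F : Set (Sym2 V))).Reachable (a 0) (a 3)),
    Real.tanh β ^ F.card with hJ
  have hcE0 : 0 < cE := pow_pos (Real.cosh_pos β) _
  have hJ0 : 0 ≤ J := Finset.sum_nonneg fun F _ => pow_nonneg ht _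
  have hZt0 : ∀ S, 0 ≤ Zt S := fun S => loopO1PartitionFunction_nonneg G ht S
  -- `Z_β[S] = cosh(β)^{|E|} · Z^S_{tanh β}` (the pushforward with the trivial event)
  have hZ : ∀ S, ecurrentSum (fun _ : G.edgeFinset => β) S = ENNReal.ofReal (cE * Zt S) := by
    intro S
    have h := junkB_pushforward G hβ S (fun _ => True)
    rw [Finset.filter_true] at h
    simp only [if_true, mul_one] at h
    rw [hZt]
    dsimp only
    rw [StrandShadowNegative.loopO1PartitionFunction_eq_sum_tJoins G, ← h]
    rfl
  have key := junkB_current_ineq G hβ a ha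
  rw [hZ, hZ, hZ, ← ENNReal.ofReal_mul (mul_nonneg hcE0.le hJ0),
    ← ENNReal.ofReal_mul (mul_nonneg hcE0.le (hZt0 _)),
    ENNReal.ofReal_le_ofReal_iff (mul_nonneg (mul_nonneg hcE0.le (hZt0 _))
      (mul_nonneg hcE0.le (hZt0 _)))] at key
  refine le_of_mul_le_mul_left ?_ (mul_pos hcE0 hcE0)
  calc cE * cE * (J * Zt ∅) = cE * J * (cE * Zt ∅) := by ring
    _ ≤ cE * Zt (Finset.univ.image a) * (cE * Zt {a 2, a 3}) := key
    _ = cE * cE * (Zt (Finset.univ.image a) * Zt {a 2, a 3}) := by ring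

end Summit.CriticalPhenomena.Ising3DConformalLimit.Theorems.StrandShadowOddCut

end
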